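import Summits.Ventures.LatticeQCDFlow.Scaling.HubModeGap

/-!
HONEST FRAMING: exact (Metropolis-corrected) sampling algorithms for lattice gauge theory; figures
of merit are autocorrelation/cost numbers at stated couplings and volumes; no continuum-physics
claim.

# HubModeAllocation — UPDATE ALLOCATION AND SWAP-GRAPH DILUTION IN THE HUB MODE-GAP FLOOR: FOR ANY SWAP GRAPH OF `m`
# EDGES CONTAINING THE HUB AND ANY WEIGHTS `w` WITH `w_k ≥ w_⋆ > 0`,
# `Gap ≥ p(1−t)γ_A·w_⋆·min{tδ₂K/m, γ₀(1−t)w_0}/(56K)` — LINEAR IN THE SMALLEST UPDATE WEIGHT AND IN THE HOT WEIGHT;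
# UNIFORM ALLOCATION (ONE UNIFORMLY CHOSEN REPLICA PER UPDATE, `ptGraphSampler`): ORDER `K⁻³`,
# `Gap ≥ p(1−t)γ_A·min{tδ₂, γ₀(1−t)}/(56K(K+1)²)`; THE BALANCED ALLOCATION OF `Scaling/HubModeGap`: ORDER `K⁻²`
# (lean-2 GEN-22, ours)

Venture-side (OURS).  Cell `lqcd-flow` (pub-lqcd), unit `pub-lqcd-lean-2-g22`, 2026-08-26.  Chapter J, file 7.
`Scaling/HubModeGap.hubMode_spectralGap_ge` (J3) holds for every swap graph containing the hub edges and every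
allocation `w` of the single-replica updates; this file reads off the closed form in `w` and `m` and the two
allocations practitioners use.  In the floor the hot weight `w_0` multiplies the hot replica's sector-crossing rate
`γ₀` (the star conveyor's relabel budget), the smallest weight `w_⋆` multiplies the within-sector relaxation `γ_A` of
the slowest-updated replica (the restriction chains), and a swap graph with `m ≥ K` edges proposes each hub edge with
probability `1/m` (dilution `K/m` of the transposition budget).  Compare `Scaling/WeightedHubSchemeFloor` /
`Scaling/WeightedLadderLaw` (identical levels: hot-only allocation attains the linear law on the hub and changes
nothing on the ladder): WITH metastable cold levels the hot-only allocation has NO floor of this kind (`w_⋆ = 0`: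
a cold replica caught in a sector other than the hot replica's is never refreshed inside it), and the balanced
allocation `w_0 = ½`, `w_{k+1} = 1/(2K)` is, up to the constant, the best this floor offers (`w_⋆ ≤ (1 − w_0)/K`).

## What is proved

* **`hubModeWeighted_spectralGap_ge`** — `m ≥ K` edges containing the hub, `w_k ≥ w_⋆ > 0`, `0 < t < 1`,
  `p, δ₂, γ_A ≤ 1`: `Gap ≥ p(1−t)γ_A·w_⋆·min{tδ₂K/m, γ₀(1−t)w_0}/(56K)`.
* **`hubModeUniform_spectralGap_ge`** — the star with one uniformly chosen replica per update
  (`ptGraphSampler t μ M e_⋆ 1` of `Scaling/ReplicaExchangeGraphSwap`): `Gap ≥ p(1−t)γ_A·min{tδ₂, γ₀(1−t)}/(56K(K+1)²)`.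
* **`hubModeWeighted_floor_le_balanced`** — for every probability vector `w` the allocation factor obeys
  `w_⋆·min{a, b·w_0} ≤ min{a, b}/K` (`w_⋆ ≤ w_k` for all `k`, `K ≥ 1`, `a, b ≥ 0`): no allocation lifts this floor above
  order `K⁻²`, which the balanced allocation attains (`Scaling/HubModeGap.hubModeBalanced_spectralGap_ge`).

NOT CLAIMED: that the sampler itself (rather than this floor) is slower for other allocations; sharp constants;
anything measured.  Literature grade (cell rule): ELEMENTARY COROLLARIES; nothing cited as a fact; no new bib keys.
-/

noncomputable section

open Finset Function
open Literature.Probability.MarkovChains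
open Literature.Probability.MarkovChains.Decomposition

namespace Summit.Ventures.LatticeQCDFlow.Scaling

section Allocation

variable {S J : Type*} [Fintype S] [DecidableEq S] [Fintype J] [DecidableEq J] {K m : ℕ}
  {μ : Fin (K + 1) → S → ℝ} (hμ : ∀ k x, 0 < μ k x) (hμ1 : ∀ k, ∑ x, μ k x = 1)
  {M : Fin (K + 1) → S → S → ℝ} {w : Fin (K + 1) → ℝ} {mode : S → J} (hmode : Function.Surjective mode) {t : ℝ}
  {e : Fin m → Fin (K + 1) × Fin (K + 1)}

include hμ hμ1 hmode in
/-- **THE HUB MODE-GAP FLOOR IN CLOSED FORM FOR ANY ALLOCATION AND ANY SWAP GRAPH CONTAINING THE HUB:**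
`Gap ≥ p(1−t)γ_A·w_⋆·min{tδ₂K/m, γ₀(1−t)w_0}/(56K)` (`m ≥ K ≥ 1` edges with distinct endpoints and identity maps
containing every `(0, k+1)`; `w ≥ w_⋆ > 0` coordinatewise, `Σw = 1`; `0 < t < 1`; `p, δ₂, γ_A ≤ 1`). [ours] -/
theorem hubModeWeighted_spectralGap_ge [Nontrivial S] (hK : 1 ≤ K) (hm : K ≤ m) (he : ∀ r, (e r).1 ≠ (e r).2)
    (hhub : ∀ k : Fin K, ∃ j, e j = ((0 : Fin (K + 1)), k.succ)) (hM : ∀ k, IsRowStochastic (M k))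
    (hMrev : ∀ k, DetailedBalance (μ k) (M k)) (hw0 : ∀ k, 0 ≤ w k) (hw1 : ∑ k, w k = 1) {wmin : ℝ}
    (hwmin0 : 0 < wmin) (hwmin : ∀ k, wmin ≤ w k) (ht0 : 0 < t) (ht1 : t < 1)
    {p δ₂ γ₀ γA : ℝ} (hp : 0 < p) (hp1 : p ≤ 1) (hδ0 : 0 < δ₂) (hδ1 : δ₂ ≤ 1) (hγ₀ : 0 < γ₀) (hγA : 0 < γA)
    (hγA1 : γA ≤ 1)
    (hpers : ∀ (k : Fin K) (j : J), p * blockMass (μ k.succ) mode j ≤ blockMass (μ 0) mode j)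
    (hδ : ∀ (i : Fin (K + 1) → J) (k : Fin K), i ∘ Equiv.swap (0 : Fin (K + 1)) k.succ ≠ i →
      δ₂ * min (blockMass (tensorFun μ) (fun z : Fin (K + 1) → S => mode ∘ z) i)
          (blockMass (tensorFun μ) (fun z : Fin (K + 1) → S => mode ∘ z) (i ∘ Equiv.swap (0 : Fin (K + 1)) k.succ))
        ≤ ∑ x ∈ block (fun z : Fin (K + 1) → S => mode ∘ z) i,
            min (tensorFun μ x) (tensorFun μ (x ∘ Equiv.swap (0 : Fin (K + 1)) k.succ)))
    (hgap0 : ∀ h : J → ℝ, γ₀ * lawVariance (blockMass (μ 0) mode) h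
      ≤ dirichletForm (blockMass (μ 0) mode) (projectionChain (μ 0) (M 0) mode) h)
    (hgapA : ∀ k j, ∀ h : S → ℝ, γA * lawVariance (blockLaw (μ k) mode j) h
      ≤ dirichletForm (blockLaw (μ k) mode j) (restrictionChain (M k) mode) h) :
    p * (1 - t) * γA * wmin * min (t * δ₂ * K / m) (γ₀ * (1 - t) * w 0) / (56 * K)
      ≤ spectralGap (tensorFun μ) (fun x y : Fin (K + 1) → S =>
          t * ptGraphSwap μ e (fun _ : Fin m => Equiv.refl S) x y + (1 - t) * prodKernel w M x y) := by
  have hKr : (1 : ℝ) ≤ K := by exact_mod_cast hK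
  have hK0 : (0 : ℝ) < K := by linarith
  have hmr : (K : ℝ) ≤ m := by exact_mod_cast hm
  have hm0 : (0 : ℝ) < m := by linarith
  have h1t : 0 < 1 - t := by linarith
  have hwhot : 0 < w 0 := lt_of_lt_of_le hwmin0 (hwmin 0)
  have hw0le : w 0 ≤ 1 := by
    calc w 0 ≤ ∑ k, w k := single_le_sum (fun k _ => hw0 k) (mem_univ 0)
      _ = 1 := hw1
  have hwminle : wmin ≤ 1 := (hwmin 0).trans hw0le
  set m₀ := min (t * δ₂ * K / m) (γ₀ * (1 - t) * w 0) with hm₀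
  have hm₀pos : 0 < m₀ := lt_min (by positivity) (by positivity)
  have hm₀le : m₀ ≤ 1 := by
    have h1 : m₀ ≤ t * δ₂ * K / m := min_le_left _ _
    have h2 : t * δ₂ * K / m ≤ 1 := by
      rw [div_le_one hm0]
      calc t * δ₂ * K ≤ 1 * 1 * K := by
            refine mul_le_mul (mul_le_mul ht1.le hδ1 hδ0.le zero_le_one) le_rfl hK0.le (by positivity)
        _ = K := by ring
        _ ≤ m := hmr
    exact h1.trans h2
  -- the admissible constant `C = p m₀/(14K)`
  set C := p * m₀ / (14 * K) with hC
  have hCpos : 0 < C := by positivity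
  have hC1 : C * (6 * m) ≤ p * (t * δ₂) := by
    have h1 : m₀ ≤ t * δ₂ * K / m := min_le_left _ _
    have h1' : m₀ * m ≤ t * δ₂ * K := by rwa [le_div_iff₀ hm0] at h1
    rw [hC]
    calc p * m₀ / (14 * K) * (6 * m) = p * (m₀ * m) * (6 / (14 * K)) := by field_simp
      _ ≤ p * (t * δ₂ * K) * (6 / (14 * K)) := by
          refine mul_le_mul_of_nonneg_right (mul_le_mul_of_nonneg_left h1' hp.le) (by positivity)
      _ = p * (t * δ₂) * (6 / 14) := by field_simp
      _ ≤ p * (t * δ₂) := by nlinarith [mul_pos hp (mul_pos ht0 hδ0)]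
  have hC2 : C * (2 * (p + 6 * K)) ≤ p * γ₀ * ((1 - t) * w 0) := by
    have h2 : m₀ ≤ γ₀ * (1 - t) * w 0 := min_le_right _ _
    have h3 : 2 * (p + 6 * (K : ℝ)) ≤ 14 * K := by nlinarith
    rw [hC]
    calc p * m₀ / (14 * K) * (2 * (p + 6 * K)) ≤ p * m₀ / (14 * K) * (14 * K) :=
          mul_le_mul_of_nonneg_left h3 (by positivity)
      _ = p * m₀ := by field_simp
      _ ≤ p * (γ₀ * (1 - t) * w 0) := mul_le_mul_of_nonneg_left h2 hp.le
      _ = p * γ₀ * ((1 - t) * w 0) := by ring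
  have hcw : ∀ k : Fin (K + 1), wmin * γA ≤ w k * γA := fun k => mul_le_mul_of_nonneg_right (hwmin k) hγA.le
  have key := hubMode_spectralGap_ge hμ hμ1 hmode (le_trans hK hm) he hhub hM hMrev hw0 hw1 hwhot ht0 ht1 hp hδ0 hγ₀
    (mul_pos hwmin0 hγA) hcw hpers hδ hgap0 hgapA hCpos hC1 hC2
  refine le_trans ?_ key
  -- `C ≤ 1/14`, so `min{C/3, C(1−t)w_⋆γ_A/(3 + C)} ≥ C(1−t)w_⋆γ_A/4 = p(1−t)γ_A w_⋆ m₀/(56K)`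
  have hCle : C ≤ 1 / 14 := by
    rw [hC, div_le_iff₀ (by positivity)]
    have : p * m₀ ≤ 1 := by nlinarith
    nlinarith
  have hval : p * (1 - t) * γA * wmin * m₀ / (56 * K) = C * ((1 - t) * (wmin * γA)) / 4 := by
    rw [hC]; field_simp; ring
  rw [hval]
  have hlam : (1 - t) * (wmin * γA) ≤ 1 := by
    have h1 : 1 - t ≤ 1 := by linarith
    have h2 : wmin * γA ≤ 1 := by nlinarith
    calc (1 - t) * (wmin * γA) ≤ 1 * 1 := mul_le_mul h1 h2 (by positivity) zero_le_one
      _ = 1 := by ring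
  refine le_min ?_ ?_
  · rw [div_le_div_iff₀ (by norm_num) (by norm_num)]
    nlinarith [mul_le_mul_of_nonneg_left hlam hCpos.le]
  · rw [show (3 : ℝ) * 1 + C = 3 + C by ring, div_le_div_iff₀ (by norm_num) (by positivity)]
    have h3 : 3 + C ≤ 4 := by linarith
    exact mul_le_mul_of_nonneg_left h3 (by positivity)

include hμ hμ1 hmode in
/-- **UNIFORM ALLOCATION (one uniformly chosen replica per update), THE STAR: ORDER `K⁻³`** —
`Gap(ptGraphSampler t μ M e_⋆ 1) ≥ p(1−t)γ_A·min{tδ₂, γ₀(1−t)}/(56K(K+1)²)` (`K ≥ 1`, `0 < t < 1`, `p, δ₂, γ_A ≤ 1`).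
[ours] -/
theorem hubModeUniform_spectralGap_ge [Nontrivial S] (hK : 1 ≤ K) (hM : ∀ k, IsRowStochastic (M k))
    (hMrev : ∀ k, DetailedBalance (μ k) (M k)) (ht0 : 0 < t) (ht1 : t < 1)
    {p δ₂ γ₀ γA : ℝ} (hp : 0 < p) (hp1 : p ≤ 1) (hδ0 : 0 < δ₂) (hδ1 : δ₂ ≤ 1) (hγ₀ : 0 < γ₀) (hγA : 0 < γA)
    (hγA1 : γA ≤ 1)
    (hpers : ∀ (k : Fin K) (j : J), p * blockMass (μ k.succ) mode j ≤ blockMass (μ 0) mode j)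
    (hδ : ∀ (i : Fin (K + 1) → J) (k : Fin K), i ∘ Equiv.swap (0 : Fin (K + 1)) k.succ ≠ i →
      δ₂ * min (blockMass (tensorFun μ) (fun z : Fin (K + 1) → S => mode ∘ z) i)
          (blockMass (tensorFun μ) (fun z : Fin (K + 1) → S => mode ∘ z) (i ∘ Equiv.swap (0 : Fin (K + 1)) k.succ))
        ≤ ∑ x ∈ block (fun z : Fin (K + 1) → S => mode ∘ z) i,
            min (tensorFun μ x) (tensorFun μ (x ∘ Equiv.swap (0 : Fin (K + 1)) k.succ)))
    (hgap0 : ∀ h : J → ℝ, γ₀ * lawVariance (blockMass (μ 0) mode) h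
      ≤ dirichletForm (blockMass (μ 0) mode) (projectionChain (μ 0) (M 0) mode) h)
    (hgapA : ∀ k j, ∀ h : S → ℝ, γA * lawVariance (blockLaw (μ k) mode j) h
      ≤ dirichletForm (blockLaw (μ k) mode j) (restrictionChain (M k) mode) h) :
    p * (1 - t) * γA * min (t * δ₂) (γ₀ * (1 - t)) / (56 * K * (K + 1) ^ 2)
      ≤ spectralGap (tensorFun μ)
          (ptGraphSampler t μ M (fun k : Fin K => ((0 : Fin (K + 1)), k.succ)) (fun _ : Fin K => Equiv.refl S)) := by
  have hKr : (1 : ℝ) ≤ K := by exact_mod_cast hK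
  have hK0 : (0 : ℝ) < K := by linarith
  have h1t : 0 < 1 - t := by linarith
  have h := hubModeWeighted_spectralGap_ge hμ hμ1 hmode (e := fun k : Fin K => ((0 : Fin (K + 1)), k.succ))
    (w := fun _ : Fin (K + 1) => (1 : ℝ) / (K + 1)) hK le_rfl (fun k => (Fin.succ_ne_zero k).symm) (fun k => ⟨k, rfl⟩)
    hM hMrev (fun _ => by positivity) (sum_uniform_weight K) (by positivity : (0 : ℝ) < 1 / (K + 1)) (fun _ => le_rfl)
    ht0 ht1 hp hp1 hδ0 hδ1 hγ₀ hγA hγA1 hpers hδ hgap0 hgapA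
  have hKK : t * δ₂ * K / K = t * δ₂ := by field_simp
  rw [hKK] at h
  refine le_trans ?_ h
  -- `min{tδ₂, γ₀(1−t)}/(K+1) ≤ min{tδ₂, γ₀(1−t)/(K+1)}`
  have hmin : min (t * δ₂) (γ₀ * (1 - t)) / (K + 1) ≤ min (t * δ₂) (γ₀ * (1 - t) * (1 / (K + 1))) := by
    refine le_min ?_ ?_
    · calc min (t * δ₂) (γ₀ * (1 - t)) / (K + 1) ≤ min (t * δ₂) (γ₀ * (1 - t)) / 1 :=
            div_le_div_of_nonneg_left (le_min (by positivity) (by positivity)) one_pos (by linarith)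
        _ ≤ t * δ₂ := by rw [div_one]; exact min_le_left _ _
    · rw [show γ₀ * (1 - t) * (1 / (K + 1)) = γ₀ * (1 - t) / (K + 1) by ring]
      exact div_le_div_of_nonneg_right (min_le_right _ _) (by positivity)
  calc p * (1 - t) * γA * min (t * δ₂) (γ₀ * (1 - t)) / (56 * K * (K + 1) ^ 2)
      = p * (1 - t) * γA * (1 / (K + 1)) * (min (t * δ₂) (γ₀ * (1 - t)) / (K + 1)) / (56 * K) := by
        field_simp
    _ ≤ p * (1 - t) * γA * (1 / (K + 1)) * min (t * δ₂) (γ₀ * (1 - t) * (1 / (K + 1))) / (56 * K) :=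
        div_le_div_of_nonneg_right (mul_le_mul_of_nonneg_left hmin (by positivity)) (by positivity)

omit [Fintype S] [DecidableEq S] [Fintype J] [DecidableEq J] in
/-- **NO ALLOCATION LIFTS THIS FLOOR ABOVE ORDER `K⁻²`:** for a probability vector `w` on `K+1` levels with `w_k ≥ w_⋆`
for all `k` and `a, b ≥ 0`: `w_⋆·min{a, b·w_0} ≤ min{a, b}/K` — since `K·w_⋆ ≤ Σ_{k≥1} w_k = 1 − w_0 ≤ 1` and
`w_⋆·w_0 ≤ w_⋆ ≤ 1/K`; the balanced allocation gives `min{a, b/2}/(2K)`. [ours] -/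
theorem hubModeWeighted_floor_le_balanced (hK : 1 ≤ K) {w : Fin (K + 1) → ℝ} (hw0 : ∀ k, 0 ≤ w k)
    (hw1 : ∑ k, w k = 1) {wmin : ℝ} (hwmin : ∀ k, wmin ≤ w k) {a b : ℝ} (ha : 0 ≤ a) (hb : 0 ≤ b) :
    wmin * min a (b * w 0) ≤ min a b / K := by
  have hKr : (1 : ℝ) ≤ K := by exact_mod_cast hK
  have hK0 : (0 : ℝ) < K := by linarith
  -- `K·w_⋆ ≤ Σ_{k ≥ 1} w_k ≤ 1`
  have hsum : (K : ℝ) * wmin ≤ 1 := by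
    have h1 : ∑ k : Fin K, wmin ≤ ∑ k : Fin K, w k.succ := sum_le_sum fun k _ => hwmin k.succ
    rw [sum_const, card_univ, Fintype.card_fin, nsmul_eq_mul] at h1
    have h2 : ∑ k : Fin K, w k.succ ≤ 1 := by
      have := hw1
      rw [Fin.sum_univ_succ] at this
      linarith [hw0 0]
    linarith
  have hwK : wmin ≤ 1 / K := by rw [le_div_iff₀ hK0, mul_comm]; exact hsum
  have hw0le : w 0 ≤ 1 := by
    calc w 0 ≤ ∑ k, w k := single_le_sum (fun k _ => hw0 k) (mem_univ 0)
      _ = 1 := hw1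
  by_cases hwm : wmin ≤ 0
  · calc wmin * min a (b * w 0) ≤ 0 := mul_nonpos_of_nonpos_of_nonneg hwm (le_min ha (mul_nonneg hb (hw0 0)))
      _ ≤ min a b / K := div_nonneg (le_min ha hb) hK0.le
  · push Not at hwm
    rw [le_div_iff₀ hK0]
    calc wmin * min a (b * w 0) * K = (K * wmin) * min a (b * w 0) := by ring
      _ ≤ 1 * min a (b * w 0) :=
          mul_le_mul_of_nonneg_right hsum (le_min ha (mul_nonneg hb (hw0 0)))
      _ ≤ min a b := by
          rw [one_mul]
          exact min_le_min le_rfl (by nlinarith)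

end Allocation

end Summit.Ventures.LatticeQCDFlow.Scaling

end
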